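import Mathlib.Combinatorics.SimpleGraph.Connectivity.Connected
import Literature.Combinatorics.SimpleGraph.SwitchingEquivalentGraph

/-!
# No crossing along switching edges (per-path reduction for `NoHiddenOrder`, stmt-PneNP-14781)

Route `PneNP/SymmetryBudget`, dichotomy `NoHiddenOrder` (stmt-PneNP-14781) / `WindowBarrier` (stmt-PneNP-2145).
Memo `PER-PATH.md` (evidence on both items) reduces `NoHiddenOrder` to the PER-PATH Corneil–Goldberg bound via a
pointer-indexed flat canoniser; it rests on two facts about sections of equitable colourings, and this file proves the
first (Lemma 1 / Corollary 1 there). `oneSided_of_swAdj`: if `ρ` is equitable, `H` is a section of `ρ` (Laubner 2011,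
Def. 3.3.1), `ρ'` is an equitable refinement of `ρ` and `z z'` is an edge of the switching-equivalent graph `G_ρ`
(Def. 3.3.2), then "the `ρ'`-cell lies inside `H` or inside `Hᶜ`" propagates from `z` to `z'` (four-case count: side
of `z'` × kept/switched block). Hence along walks (`oneSided_of_reachable`); if `G_ρ` is connected and one `ρ'`-cell is
one-sided then all are, i.e. `H` is a union of `ρ'`-cells (`oneSided_of_preconnected`); and the `G_ρ`-component of a
`ρ'`-singleton is a union of `ρ'`-cells (`reachable_of_eq`). So individualising INSIDE a section block and re-refining
never creates a cell straddling the block. No definitions; Mathlib + the tree's `IsEquitable`/`IsSection`/`swGraph`.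
-/

-- `Summit.PneNP.PneNP.…` duplicates `PneNP` BY DESIGN (single-problem summit, D-0017 layout).
set_option linter.dupNamespace false

namespace Summit.PneNP.PneNP.Theorems

namespace PerPath

open Finset Literature.Combinatorics.SimpleGraph

variable {V : Type*} [Fintype V] [DecidableEq V]
variable {G : SimpleGraph V} [DecidableRel G.Adj]
variable {κ κ' : Type*} [DecidableEq κ] [DecidableEq κ']

/-! Throughout, "the `ρ'`-cell of `z` is ONE-SIDED w.r.t. `H`" is the inline disjunction
`(∀ w, ρ' w = ρ' z → w ∈ H) ∨ (∀ w, ρ' w = ρ' z → w ∉ H)` (no named predicate is introduced). -/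

omit [Fintype V] [DecidableEq V] [DecidableEq κ'] in
/-- One-sidedness with respect to `Hᶜ` is one-sidedness with respect to `H`. -/
theorem oneSided_compl_iff {ρ' : V → κ'} {H : Set V} {z : V} :
    ((∀ w, ρ' w = ρ' z → w ∈ Hᶜ) ∨ (∀ w, ρ' w = ρ' z → w ∉ Hᶜ)) ↔
      ((∀ w, ρ' w = ρ' z → w ∈ H) ∨ (∀ w, ρ' w = ρ' z → w ∉ H)) := by
  simp only [Set.mem_compl_iff, not_not]
  exact Or.comm

omit [Fintype V] [DecidableEq V] [DecidableEq κ'] in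
/-- One-sidedness depends only on the cell. -/
theorem oneSided_congr {ρ' : V → κ'} {H : Set V} {z w : V} (h : ρ' w = ρ' z) :
    ((∀ x, ρ' x = ρ' w → x ∈ H) ∨ (∀ x, ρ' x = ρ' w → x ∉ H)) ↔
      ((∀ x, ρ' x = ρ' z → x ∈ H) ∨ (∀ x, ρ' x = ρ' z → x ∉ H)) := by
  simp only [h]

omit [Fintype V] [DecidableEq V] [DecidableEq κ'] in
/-- A singleton cell is one-sided. -/
theorem oneSided_of_singleton {ρ' : V → κ'} (H : Set V) {z : V} (hz : ∀ w, ρ' w = ρ' z → w = z) :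
    ((∀ w, ρ' w = ρ' z → w ∈ H) ∨ (∀ w, ρ' w = ρ' z → w ∉ H)) := by
  by_cases h : z ∈ H
  · exact Or.inl fun w hw => (hz w hw).symm ▸ h
  · exact Or.inr fun w hw => (hz w hw).symm ▸ h

omit [Fintype V] [DecidableEq V] [DecidableRel G.Adj] [DecidableEq κ] in
/-- Section blocks from the `H`-side to the outside are homogeneous. -/
theorem section_adj_in_out {ρ : V → κ} {H : Set V} (hH : IsSection G ρ H) {u u' w w' : V}
    (hu : ρ u = ρ u') (hw : ρ w = ρ w') (huH : u ∈ H) (hu'H : u' ∈ H) (hwH : w ∉ H) (hw'H : w' ∉ H) :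
    G.Adj u w ↔ G.Adj u' w' :=
  hH hu hw (iff_of_true huH hu'H) (iff_of_false hwH hw'H) fun h => hwH (h.1 huH)

omit [Fintype V] [DecidableEq V] [DecidableRel G.Adj] [DecidableEq κ] in
/-- Section blocks from the outside to the `H`-side are homogeneous. -/
theorem section_adj_out_in {ρ : V → κ} {H : Set V} (hH : IsSection G ρ H) {u u' w w' : V}
    (hu : ρ u = ρ u') (hw : ρ w = ρ w') (huH : u ∉ H) (hu'H : u' ∉ H) (hwH : w ∈ H) (hw'H : w' ∈ H) :
    G.Adj u w ↔ G.Adj u' w' :=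
  hH hu hw (iff_of_false huH hu'H) (iff_of_true hwH hw'H) fun h => huH (h.2 hwH)

omit [DecidableEq V] in
/-- Splitting `adjCount` along membership in `H`. -/
theorem adjCount_split (ρ : V → κ) (H : Set V) [DecidablePred (· ∈ H)] (u : V) (j : κ) :
    adjCount G ρ u j =
      (univ.filter fun w => G.Adj u w ∧ ρ w = j ∧ w ∈ H).card +
        (univ.filter fun w => G.Adj u w ∧ ρ w = j ∧ w ∉ H).card := by
  unfold adjCount
  rw [← card_filter_add_card_filter_not (p := fun w => w ∈ H), filter_filter, filter_filter]
  simp only [and_assoc]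

omit [DecidableEq V] [DecidableRel G.Adj] in
/-- Splitting `cellCard` along membership in `H`. -/
theorem cellCard_split (ρ : V → κ) (H : Set V) [DecidablePred (· ∈ H)] (j : κ) :
    cellCard ρ j = (univ.filter fun w => ρ w = j ∧ w ∈ H).card + (univ.filter fun w => ρ w = j ∧ w ∉ H).card := by
  unfold cellCard
  rw [← card_filter_add_card_filter_not (p := fun w => w ∈ H), filter_filter, filter_filter]

/-- **No crossing along switching edges** (PER-PATH.md, Lemma 1). Let `ρ` be equitable, `H` a section of `ρ`,
`ρ'` an equitable refinement of `ρ`. If `z z'` is an edge of the switching-equivalent graph `G_ρ` and the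
`ρ'`-cell of `z` is one-sided w.r.t. `H`, so is the `ρ'`-cell of `z'`. -/
theorem oneSided_of_swAdj {ρ : V → κ} {ρ' : V → κ'} (hρ : IsEquitable G ρ) {H : Set V} (hH : IsSection G ρ H)
    (hρ' : IsEquitable G ρ') (href : ∀ u v, ρ' u = ρ' v → ρ u = ρ v)
    {z z' : V} (hadj : (swGraph G ρ).Adj z z')
    (hz : ((∀ w, ρ' w = ρ' z → w ∈ H) ∨ (∀ w, ρ' w = ρ' z → w ∉ H))) :
    ((∀ w, ρ' w = ρ' z' → w ∈ H) ∨ (∀ w, ρ' w = ρ' z' → w ∉ H)) := by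
  classical
  -- reduce to the case where the cell of `z` lies inside `H`
  suffices key : ∀ H : Set V, IsSection G ρ H → (∀ w, ρ' w = ρ' z → w ∈ H) →
      ((∀ w, ρ' w = ρ' z' → w ∈ H) ∨ (∀ w, ρ' w = ρ' z' → w ∉ H)) by
    rcases hz with h | h
    · exact key H hH h
    · exact oneSided_compl_iff.1 (key Hᶜ hH.compl fun w hw => h w hw)
  intro H hH hzH
  by_contra hnot
  -- a vertex `y` of the cell of `z'` on the other side of `H`
  obtain ⟨y, hy, hyside⟩ : ∃ y, ρ' y = ρ' z' ∧ ¬ (y ∈ H ↔ z' ∈ H) := by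
    push Not at hnot
    obtain ⟨⟨w₁, hw₁, hw₁H⟩, ⟨w₂, hw₂, hw₂H⟩⟩ := hnot
    by_cases hz'H : z' ∈ H
    · exact ⟨w₁, hw₁, fun h => hw₁H (h.2 hz'H)⟩
    · exact ⟨w₂, hw₂, fun h => hz'H (h.1 hw₂H)⟩
  -- the cell of `z'` is not the cell of `z`
  have hzz' : ρ' z' ≠ ρ' z := fun h => hnot ((oneSided_congr h).2 (Or.inl hzH))
  -- names
  set i : κ := ρ z with hi
  set j : κ := ρ z' with hj
  set I : κ' := ρ' z with hI
  have hρy : ρ y = j := href y z' hy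
  -- the switching edge
  have hsw : G.Adj z z' ↔ ¬ Switch G ρ i j := (swGraph_adj.1 hadj).2
  have hK : Switch G ρ i j ↔ cellCard ρ j < 2 * adjCount G ρ z j := switch_iff_of_isEquitable hρ z j
  -- the four blocks
  set C1 : Finset V := univ.filter fun w => ρ w = j ∧ w ∈ H with hC1
  set C0 : Finset V := univ.filter fun w => ρ w = j ∧ w ∉ H with hC0
  have hcell : cellCard ρ j = C1.card + C0.card := cellCard_split ρ H j
  -- neighbour counts into the two halves of class `j`
  set n1 : V → ℕ := fun u => (univ.filter fun w => G.Adj u w ∧ ρ w = j ∧ w ∈ H).card with hn1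
  set n0 : V → ℕ := fun u => (univ.filter fun w => G.Adj u w ∧ ρ w = j ∧ w ∉ H).card with hn0
  have hsplit : ∀ u, adjCount G ρ u j = n1 u + n0 u := fun u => adjCount_split ρ H u j
  have hn0_le : ∀ u, n0 u ≤ C0.card := fun u =>
    card_le_card fun w hw => by
      simp only [hC0, mem_filter, mem_univ, true_and] at hw ⊢
      exact hw.2
  -- equitability of `ρ`: the count `a` is constant on class `i`
  have ha : ∀ u, ρ u = i → adjCount G ρ u j = adjCount G ρ z j := fun u hu => hρ.adjCount_eq hu j
  -- the bit `s` : block `(H ∩ P_i) × (P_j \ H)`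
  have hs : (∀ u, ρ u = i → u ∈ H → ∀ w, ρ w = j → w ∉ H → G.Adj u w) ∨
      (∀ u, ρ u = i → u ∈ H → ∀ w, ρ w = j → w ∉ H → ¬ G.Adj u w) := by
    by_cases hex : ∃ u w, ρ u = i ∧ u ∈ H ∧ ρ w = j ∧ w ∉ H ∧ G.Adj u w
    · obtain ⟨u₁, w₁, hu₁, hu₁H, hw₁, hw₁H, hadj₁⟩ := hex
      exact Or.inl fun u hu huH w hw hwH =>
        (section_adj_in_out hH (hu.trans hu₁.symm) (hw.trans hw₁.symm) huH hu₁H hwH hw₁H).2 hadj₁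
    · push Not at hex
      exact Or.inr fun u hu huH w hw hwH h => hex u w hu huH hw hwH h
  -- the bit `s'` : block `(P_i \ H) × (H ∩ P_j)`
  have hs' : (∀ u, ρ u = i → u ∉ H → ∀ w, ρ w = j → w ∈ H → G.Adj u w) ∨
      (∀ u, ρ u = i → u ∉ H → ∀ w, ρ w = j → w ∈ H → ¬ G.Adj u w) := by
    by_cases hex : ∃ u w, ρ u = i ∧ u ∉ H ∧ ρ w = j ∧ w ∈ H ∧ G.Adj u w
    · obtain ⟨u₁, w₁, hu₁, hu₁H, hw₁, hw₁H, hadj₁⟩ := hex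
      exact Or.inl fun u hu huH w hw hwH =>
        (section_adj_out_in hH (hu.trans hu₁.symm) (hw.trans hw₁.symm) huH hu₁H hwH hw₁H).2 hadj₁
    · push Not at hex
      exact Or.inr fun u hu huH w hw hwH h => hex u w hu huH hw hwH h
  -- consequences of the bits for the counts
  have hn0_full : (∀ u, ρ u = i → u ∈ H → ∀ w, ρ w = j → w ∉ H → G.Adj u w) →
      ∀ u, ρ u = i → u ∈ H → n0 u = C0.card := by
    intro h u hu huH
    simp only [hn0, hC0]
    congr 1
    ext w
    simp only [mem_filter, mem_univ, true_and]
    exact ⟨fun hw => hw.2, fun hw => ⟨h u hu huH w hw.1 hw.2, hw⟩⟩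
  have hn0_zero : (∀ u, ρ u = i → u ∈ H → ∀ w, ρ w = j → w ∉ H → ¬ G.Adj u w) →
      ∀ u, ρ u = i → u ∈ H → n0 u = 0 := by
    intro h u hu huH
    simp only [hn0, card_eq_zero, filter_eq_empty_iff, mem_univ, true_implies]
    exact fun w hw => h u hu huH w hw.2.1 hw.2.2 hw.1
  have hn1_full : (∀ u, ρ u = i → u ∉ H → ∀ w, ρ w = j → w ∈ H → G.Adj u w) →
      ∀ u, ρ u = i → u ∉ H → n1 u = C1.card := by
    intro h u hu huH
    simp only [hn1, hC1]
    congr 1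
    ext w
    simp only [mem_filter, mem_univ, true_and]
    exact ⟨fun hw => hw.2, fun hw => ⟨h u hu huH w hw.1 hw.2, hw⟩⟩
  have hn1_zero : (∀ u, ρ u = i → u ∉ H → ∀ w, ρ w = j → w ∈ H → ¬ G.Adj u w) →
      ∀ u, ρ u = i → u ∉ H → n1 u = 0 := by
    intro h u hu huH
    simp only [hn1, card_eq_zero, filter_eq_empty_iff, mem_univ, true_implies]
    exact fun w hw => h u hu huH w hw.2.1 hw.2.2 hw.1
  -- a vertex of `P_i \ H` bounds the common count `a` from one side
  have hB0_bound : ∀ u₀, ρ u₀ = i → u₀ ∉ H →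
      adjCount G ρ z j ≤ C0.card ∨ C1.card ≤ adjCount G ρ z j := by
    intro u₀ hu₀ hu₀H
    have hau := hsplit u₀
    have hau' := ha u₀ hu₀
    have h0 := hn0_le u₀
    rcases hs' with hs'F | hs'E
    · have := hn1_full hs'F u₀ hu₀ hu₀H
      right; omega
    · have := hn1_zero hs'E u₀ hu₀ hu₀H
      left; omega
  -- the `ρ'`-cell `C` of `z` and the counts `m x = #(N(x) ∩ C)`
  set C : Finset V := univ.filter fun w => ρ' w = I with hC
  have hC_sub : ∀ w, ρ' w = I → ρ w = i ∧ w ∈ H := fun w hw => ⟨href w z hw, hzH w hw⟩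
  have hzC : z ∈ C := by simp [hC, hI]
  have hCpos : 1 ≤ C.card := card_pos.2 ⟨z, hzC⟩
  have hm_eq : adjCount G ρ' z' I = adjCount G ρ' y I := hρ'.adjCount_eq hy.symm I
  -- `m x` for `x ∈ P_j \ H`
  have hm_out_full : (∀ u, ρ u = i → u ∈ H → ∀ w, ρ w = j → w ∉ H → G.Adj u w) →
      ∀ x, ρ x = j → x ∉ H → adjCount G ρ' x I = C.card := by
    intro h x hx hxH
    simp only [adjCount, hC]
    congr 1
    ext w
    simp only [mem_filter, mem_univ, true_and]
    refine ⟨fun hw => hw.2, fun hw => ⟨?_, hw⟩⟩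
    exact (h w (hC_sub w hw).1 (hC_sub w hw).2 x hx hxH).symm
  have hm_out_zero : (∀ u, ρ u = i → u ∈ H → ∀ w, ρ w = j → w ∉ H → ¬ G.Adj u w) →
      ∀ x, ρ x = j → x ∉ H → adjCount G ρ' x I = 0 := by
    intro h x hx hxH
    simp only [adjCount, card_eq_zero, filter_eq_empty_iff, mem_univ, true_implies]
    intro w hw
    exact h w (hC_sub w hw.2).1 (hC_sub w hw.2).2 x hx hxH hw.1.symm
  -- `B₀ = P_i \ H` empty or not, and its consequences for the switching status from the `j` side
  have hswitch_j : ∀ x, ρ x = j → (Switch G ρ i j ↔ cellCard ρ i < 2 * adjCount G ρ x i) := by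
    intro x hx
    rw [switch_comm, ← hx]
    exact switch_iff_of_isEquitable hρ x (ρ z)
  have hcellI : 1 ≤ cellCard ρ i := card_pos.2 ⟨z, by simp [hi]⟩
  -- `adjCount x i` when `B₀ = ∅` and the `s`-block is full / empty, for `x ∈ P_j \ H`
  have hxi_full : (∀ u, ρ u = i → u ∈ H) → (∀ u, ρ u = i → u ∈ H → ∀ w, ρ w = j → w ∉ H → G.Adj u w) →
      ∀ x, ρ x = j → x ∉ H → adjCount G ρ x i = cellCard ρ i := by
    intro hB0 h x hx hxH
    simp only [adjCount, cellCard]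
    congr 1
    ext u
    simp only [mem_filter, mem_univ, true_and]
    exact ⟨fun hu => hu.2, fun hu => ⟨(h u hu (hB0 u hu) x hx hxH).symm, hu⟩⟩
  have hxi_zero : (∀ u, ρ u = i → u ∈ H) → (∀ u, ρ u = i → u ∈ H → ∀ w, ρ w = j → w ∉ H → ¬ G.Adj u w) →
      ∀ x, ρ x = j → x ∉ H → adjCount G ρ x i = 0 := by
    intro hB0 h x hx hxH
    simp only [adjCount, card_eq_zero, filter_eq_empty_iff, mem_univ, true_implies]
    intro u hu
    exact h u hu.2 (hB0 u hu.2) x hx hxH hu.1.symm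
  -- main case analysis on the side of `z'`
  have hzH' : z ∈ H := hzH z rfl
  by_cases hz'H : z' ∈ H
  · -- Case A: `z' ∈ H ∩ P_j`, `y ∈ P_j \ H`
    have hyH : y ∉ H := fun h => hyside (iff_of_true h hz'H)
    by_cases hKept : Switch G ρ i j
    · -- A, switched block: `z z' ∉ E`
      have hnadj : ¬ G.Adj z z' := fun h => (hsw.1 h) hKept
      -- `m z' ≤ |C| - 1`, hence `s = 0`
      have hmz' : adjCount G ρ' z' I + 1 ≤ C.card := by
        have : (univ.filter fun w => G.Adj z' w ∧ ρ' w = I) ⊆ C.erase z := fun w hw => by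
          simp only [hC, mem_filter, mem_univ, true_and, mem_erase] at hw ⊢
          exact ⟨fun h => hnadj (h ▸ hw.1).symm, hw.2⟩
        have := card_le_card this
        rw [card_erase_of_mem hzC] at this
        simp only [adjCount]
        omega
      rcases hs with hsF | hsE
      · have := hm_out_full hsF y hρy hyH
        omega
      -- `s = 0`: `n0 z = 0`, `a = n1 z ≤ |C1| - 1`
      have hn0z : n0 z = 0 := hn0_zero hsE z rfl hzH'
      have hn1z : n1 z + 1 ≤ C1.card := by
        have : (univ.filter fun w => G.Adj z w ∧ ρ w = j ∧ w ∈ H) ⊆ C1.erase z' := fun w hw => by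
          simp only [hC1, mem_filter, mem_univ, true_and, mem_erase] at hw ⊢
          exact ⟨fun h => hnadj (h ▸ hw.1), hw.2⟩
        have h1 := card_le_card this
        have hC1pos : 1 ≤ C1.card := card_pos.2 ⟨z', by simp [hC1, hj, hz'H]⟩
        rw [card_erase_of_mem (by simp [hC1, hj, hz'H])] at h1
        simp only [hn1]
        omega
      have hKz : cellCard ρ j < 2 * adjCount G ρ z j := hK.1 hKept
      have haz := hsplit z
      by_cases hB0 : ∃ u₀, ρ u₀ = i ∧ u₀ ∉ H
      · obtain ⟨u₀, hu₀, hu₀H⟩ := hB0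
        rcases hB0_bound u₀ hu₀ hu₀H with h | h <;> omega
      · push Not at hB0
        have h0 := hxi_zero hB0 hsE y hρy hyH
        have h1 : cellCard ρ i < 2 * adjCount G ρ y i := (hswitch_j y hρy).1 hKept
        rw [h0] at h1
        omega
    · -- A, kept block: `z z' ∈ E`
      have hadjG : G.Adj z z' := hsw.2 hKept
      have hmz' : 1 ≤ adjCount G ρ' z' I := card_pos.2 ⟨z, by simp [hI, hadjG.symm]⟩
      rcases hs with hsF | hsE
      swap
      · have := hm_out_zero hsE y hρy hyH
        omega
      -- `s = 1`: `n0 z = |C0|`, `n1 z ≥ 1`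
      have hn0z : n0 z = C0.card := hn0_full hsF z rfl hzH'
      have hn1z : 1 ≤ n1 z := card_pos.2 ⟨z', by simp [hj, hz'H, hadjG]⟩
      have hKz : ¬ cellCard ρ j < 2 * adjCount G ρ z j := fun h => hKept (hK.2 h)
      have haz := hsplit z
      by_cases hB0 : ∃ u₀, ρ u₀ = i ∧ u₀ ∉ H
      · obtain ⟨u₀, hu₀, hu₀H⟩ := hB0
        rcases hB0_bound u₀ hu₀ hu₀H with h | h <;> omega
      · push Not at hB0
        have h0 := hxi_full hB0 hsF y hρy hyH
        have := (hswitch_j y hρy).2 (by rw [h0]; omega)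
        exact hKept this
  · -- Case B: `z' ∈ P_j \ H`, `y ∈ H ∩ P_j`
    have hyH : y ∈ H := by
      by_contra h
      exact hyside (iff_of_false h hz'H)
    by_cases hKept : Switch G ρ i j
    · -- B, switched block: `z z' ∉ E`, so `s = 0`
      have hnadj : ¬ G.Adj z z' := fun h => (hsw.1 h) hKept
      rcases hs with hsF | hsE
      · exact hnadj (hsF z rfl hzH' z' rfl hz'H)
      have hmz' : adjCount G ρ' z' I = 0 := hm_out_zero hsE z' rfl hz'H
      have hmy : adjCount G ρ' y I = 0 := by rw [← hm_eq, hmz']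
      -- `y` is not adjacent to `z`
      have hnyz : ¬ G.Adj z y := by
        intro h
        have : 1 ≤ adjCount G ρ' y I := card_pos.2 ⟨z, by simp [hI, h.symm]⟩
        omega
      have hn0z : n0 z = 0 := hn0_zero hsE z rfl hzH'
      have hn1z : n1 z + 1 ≤ C1.card := by
        have : (univ.filter fun w => G.Adj z w ∧ ρ w = j ∧ w ∈ H) ⊆ C1.erase y := fun w hw => by
          simp only [hC1, mem_filter, mem_univ, true_and, mem_erase] at hw ⊢
          exact ⟨fun h => hnyz (h ▸ hw.1), hw.2⟩
        have h1 := card_le_card this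
        have hC1pos : 1 ≤ C1.card := card_pos.2 ⟨y, by simp [hC1, hρy, hyH]⟩
        rw [card_erase_of_mem (by simp [hC1, hρy, hyH])] at h1
        simp only [hn1]
        omega
      have hKz : cellCard ρ j < 2 * adjCount G ρ z j := hK.1 hKept
      have haz := hsplit z
      by_cases hB0 : ∃ u₀, ρ u₀ = i ∧ u₀ ∉ H
      · obtain ⟨u₀, hu₀, hu₀H⟩ := hB0
        rcases hB0_bound u₀ hu₀ hu₀H with h | h <;> omega
      · push Not at hB0
        have h0 := hxi_zero hB0 hsE z' rfl hz'H
        have h1 : cellCard ρ i < 2 * adjCount G ρ z' i := (hswitch_j z' rfl).1 hKept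
        rw [h0] at h1
        omega
    · -- B, kept block: `z z' ∈ E`, so `s = 1`
      have hadjG : G.Adj z z' := hsw.2 hKept
      rcases hs with hsF | hsE
      swap
      · exact hsE z rfl hzH' z' rfl hz'H hadjG
      have hmz' : adjCount G ρ' z' I = C.card := hm_out_full hsF z' rfl hz'H
      have hmy : adjCount G ρ' y I = C.card := by rw [← hm_eq, hmz']
      -- `y` is adjacent to `z` (it is complete to `C`)
      have hyz : G.Adj z y := by
        by_contra h
        have : (univ.filter fun w => G.Adj y w ∧ ρ' w = I) ⊆ C.erase z := fun w hw => by
          simp only [hC, mem_filter, mem_univ, true_and, mem_erase] at hw ⊢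
          exact ⟨fun h' => h (h' ▸ hw.1).symm, hw.2⟩
        have h1 := card_le_card this
        rw [card_erase_of_mem hzC] at h1
        simp only [adjCount] at hmy
        omega
      have hn0z : n0 z = C0.card := hn0_full hsF z rfl hzH'
      have hn1z : 1 ≤ n1 z := card_pos.2 ⟨y, by simp [hρy, hyH, hyz]⟩
      have hKz : ¬ cellCard ρ j < 2 * adjCount G ρ z j := fun h => hKept (hK.2 h)
      have haz := hsplit z
      by_cases hB0 : ∃ u₀, ρ u₀ = i ∧ u₀ ∉ H
      · obtain ⟨u₀, hu₀, hu₀H⟩ := hB0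
        rcases hB0_bound u₀ hu₀ hu₀H with h | h <;> omega
      · push Not at hB0
        have h0 := hxi_full hB0 hsF z' rfl hz'H
        exact hKept ((hswitch_j z' rfl).2 (by rw [h0]; omega))

/-- **Propagation along walks of the switching graph.** -/
theorem oneSided_of_reachable {ρ : V → κ} {ρ' : V → κ'} (hρ : IsEquitable G ρ) {H : Set V} (hH : IsSection G ρ H)
    (hρ' : IsEquitable G ρ') (href : ∀ u v, ρ' u = ρ' v → ρ u = ρ v)
    {z z' : V} (hzz' : (swGraph G ρ).Reachable z z')
    (hz : ((∀ w, ρ' w = ρ' z → w ∈ H) ∨ (∀ w, ρ' w = ρ' z → w ∉ H))) :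
    ((∀ w, ρ' w = ρ' z' → w ∈ H) ∨ (∀ w, ρ' w = ρ' z' → w ∉ H)) := by
  obtain ⟨p⟩ := hzz'
  induction p with
  | nil => exact hz
  | cons h _ ih => exact ih (oneSided_of_swAdj hρ hH hρ' href h hz)

/-- **Corollary 1 (i)**: if the switching graph is connected and one `ρ'`-cell is one-sided (e.g. a singleton),
then every `ρ'`-cell is one-sided: `H` is a union of `ρ'`-cells. -/
theorem oneSided_of_preconnected {ρ : V → κ} {ρ' : V → κ'} (hρ : IsEquitable G ρ) {H : Set V}
    (hH : IsSection G ρ H) (hρ' : IsEquitable G ρ') (href : ∀ u v, ρ' u = ρ' v → ρ u = ρ v)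
    (hconn : (swGraph G ρ).Preconnected) {z₀ : V}
    (hz₀ : ((∀ w, ρ' w = ρ' z₀ → w ∈ H) ∨ (∀ w, ρ' w = ρ' z₀ → w ∉ H))) (z : V) :
    ((∀ w, ρ' w = ρ' z → w ∈ H) ∨ (∀ w, ρ' w = ρ' z → w ∉ H)) :=
  oneSided_of_reachable hρ hH hρ' href (hconn z₀ z) hz₀

/-- **Corollary 1 (ii)**: the switching component of a `ρ'`-singleton `x` is a union of `ρ'`-cells: if `w` is
reachable from `x` and `ρ' u = ρ' w` then `u` is reachable from `x`. -/
theorem reachable_of_eq {ρ : V → κ} {ρ' : V → κ'} (hρ : IsEquitable G ρ) (hρ' : IsEquitable G ρ')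
    (href : ∀ u v, ρ' u = ρ' v → ρ u = ρ v) {x : V} (hx : ∀ w, ρ' w = ρ' x → w = x)
    {w u : V} (hw : (swGraph G ρ).Reachable x w) (hu : ρ' u = ρ' w) : (swGraph G ρ).Reachable x u := by
  -- the component of `x` is a section (Prop. 3.3.4)
  set K : Set V := {v | (swGraph G ρ).Reachable x v} with hK
  have hKsec : IsSection G ρ K :=
    isSection_of_swClosed fun a b ha hab => SimpleGraph.Reachable.trans ha ⟨SimpleGraph.Walk.cons hab .nil⟩
  have hxK := oneSided_of_singleton (ρ' := ρ') K hx
  have hwK := oneSided_of_reachable hρ hKsec hρ' href hw hxK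
  rcases hwK with h | h
  · exact h u hu
  · exact absurd hw (h w rfl)

end PerPath

end Summit.PneNP.PneNP.Theorems
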